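import Summits.BirchSwinnertonDyer.BirchSwinnertonDyer.Theorems.KatoDescentTamePotSupersingularCartanMuRoadRealDoorsTprime
import Summits.BirchSwinnertonDyer.BirchSwinnertonDyer.Theorems.PrintX8SmallImageTotallyRamified
import Summits.BirchSwinnertonDyer.BirchSwinnertonDyer.Theorems.AdditiveBranchIMCGordTwoRankOneSmallImageDickson
import HarnessLib

/-!
# KT `TameCoatesSujathaResidue` (stmt-19916; U₀-ns node 19202 → parent 19982) — Fukuda's index `n₀ = 0` for the
# cyclotomic `ℤ_p`-tower of ANY subfield of a normal number field of automorphism order prime to `p` (e.g. the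
# maximal real subfield `ℚ(P) = ℚ(W[3])^c` of a Cartan row), and the `hram`-FREE FUKUDA doors at `p = 3` on (t′)
# (cell `bsd-potss`, seat `bsd-potss-k8t-c4` g19; route-free; `--supports stmt-BirchSwinnertonDyer-19982 --as helper`;
# closes nothing)

HONEST FRAMING. THEOREMS ONLY (no definition, no named fact, no `sorry`). Nothing is booked; items 19916 / 19202 /
19982 stay OPEN at class level; (A), Conjecture A and BSD are proved for NO curve here.

WHY. The cell's Fukuda doors (`Literature/…/FineSelmerMuRoadDoors` Doors 2/3, k9-c4 g19's `UnitIndexMuDoors.…FukudaAt`, the X8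
doors) carry Fukuda's STANDING INDEX HYPOTHESIS `hram : ∀ κE cyclotomic, TotallyRamifiedFrom κE 0` on the field whose class
numbers are read. `Theorems/PrintX8SmallImageTotallyRamified` (cell bsd-print-x8) PROVES it for a number field that is itself
NORMAL over `ℚ` with automorphism group of exponent prime to `p` (its §1 needs `[Normal F K]`); the per-row Fukuda records of
this cell, however, read class numbers on the NON-normal maximal real subfield `ℚ(P) = ℚ(W[3])^c` (degree `4` on `3Ns`, `8` on
`3Nn` rows), where `hram` stayed DISPLAYED (certified by PARI). §1 removes the normality assumption: if `K` embeds over `ℚ`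
into a normal `L ⊆ ℚ̄` whose automorphism group has exponent dividing `d`, `p ∤ d`, then every `g^d` (`g ∈ Γ_ℚ`) lies in
`res(Γ_K)` (the range embedding `e(K)` lies in `L` — every `ℚ̄`-root of the minimal polynomial of an element of `L` lies in
`L` — and `g^d` fixes `L` pointwise), so X8's §2 applies verbatim. With Serre's Prop. 15 in the tree's PROVED form
`SmallImageDickson.not_dvd_card_aut_divisionField` this gives: for `W[p]` irreducible with `ρ̄_{W,p}` not onto, EVERY
intermediate field of `ℚ(W[p])/ℚ` has Fukuda index `0` for its cyclotomic `ℤ_p`-tower. §2: a split-Cartan-normaliser image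
is not surjective (twin of the tree's non-split lemma). §3: the `hram`-FREE Fukuda doors at `p = 3` — (A) at `(W, 3)` (any
curve) and U₀ `MissingUpperBoundAt W 3` on an irreducible rank-`0` (t′) row, `3Ns` / `3Nn`, Thm. 1 (1) (`e_{n+1} = e_n` on `ℚ(P)`)
or Thm. 1 (2) (`rank_{n+1} = rank_n`) at ANY pair of consecutive layers; displayed: the named facts, the image predicate, `W[3]`
irreducible, a complex conjugation, ONE integer equality — NO `hram`. KT use: the 19 `3Nn` U₀-ns rows graded FUKUDA-L(0,1) by
conjA-anchor g8 (a SECOND road beside their unit-twist records); K9 use: k9-c4 g19's FukudaAt records become `hram`-free.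
[cite: Fukuda1994, Thm. 1 (1), (2), p. 264 (the index `n₀`)] [cite: Washington1997, §13.1, Prop. 13.2]
[cite: Serre1972, §2.4 Prop. 15; §2.2] [cite: CoatesSujatha2005, Thm. 3.4 (§3)]
[cite: Kato2004Asterisque, Thm. 14.5 (3) (p. 236), Thm. 12.5 (3) (p. 222)] [cite: NeukirchANT1999, Ch. IV §1]
-/

set_option linter.dupNamespace false
set_option autoImplicit false

noncomputable section

open scoped Classical NumberField
open Field IntermediateField WeierstrassCurve IsDedekindDomain Polynomial
  Literature.NumberTheory.EllipticCurves Literature.NumberTheory.EllipticCurves.Rank1Residual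
  Literature.NumberTheory.EllipticCurves.Rank1Residual.Typed
  Literature.NumberTheory.GaloisRepresentations Literature.NumberTheory.SerreUniformity
  Literature.NumberTheory.IwasawaTheory
  Summit.BirchSwinnertonDyer.Rank1Residual Summit.BirchSwinnertonDyer.Rank1Residual.Additive
  Summit.BirchSwinnertonDyer.BirchSwinnertonDyer.Theorems.PrintX8TotallyRamified
  Summit.BirchSwinnertonDyer.BirchSwinnertonDyer.Theorems.AdditiveBranchIMCGordTwoRankOne

namespace Summit.BirchSwinnertonDyer.BirchSwinnertonDyer.Theorems.CartanMuRoadFukudaDoorsTprime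

/-! ### §1 Fukuda's index `n₀ = 0` below a normal field of automorphism order prime to `p` -/

section Galois

/-- **`d`-th powers of `Γ_F` restrict from `Γ_K` whenever `K` embeds over `F` into a NORMAL `L ⊆ F̄` whose
automorphism group has exponent dividing `d`** (no normality of `K`): for the range embedding `e : K → F̄` of
`exists_mem_range_absGaloisRestrict_iff` (`res(Γ_K) = Gal(F̄/e(K))`), each `e x` is an `F̄`-root of
`minpoly_F x = minpoly_F (φ x)`, which splits in the normal field `L`, so `e x ∈ L` (`Polynomial.image_rootSet`);
and `g^d` acts on `L` through `(g|_L)^d = 1`. Generalises `PrintX8TotallyRamified.pow_mem_range_absGaloisRestrict_of_pow_eq_one`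
(the case `K = L`). [cite: NeukirchANT1999, Ch. IV §1 (restriction to a subextension)] -/
theorem pow_mem_range_absGaloisRestrict_of_algHom_normal {F : Type*} [Field F]
    (L : IntermediateField F (AlgebraicClosure F)) [Normal F L] (d : ℕ)
    (hd : ∀ s : L ≃ₐ[F] L, s ^ d = 1)
    (K : Type*) [Field K] [Algebra F K] (φ : K →ₐ[F] L) (g : absoluteGaloisGroup F) :
    g ^ d ∈ (absGaloisRestrict F K).range := by
  haveI : Algebra.IsAlgebraic F L :=
    Algebra.IsAlgebraic.of_injective (IntermediateField.val L) (RingHom.injective _)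
  haveI : Algebra.IsAlgebraic F K := Algebra.IsAlgebraic.of_injective φ (RingHom.injective _)
  obtain ⟨e, he⟩ := exists_mem_range_absGaloisRestrict_iff F K
  rw [he]
  intro x
  -- `e x` is a root of `minpoly F x`, which splits in the normal field `L`
  have hint : IsIntegral F x := Algebra.IsIntegral.isIntegral x
  have hroot : e x ∈ (minpoly F x).rootSet (AlgebraicClosure F) := by
    rw [Polynomial.mem_rootSet]
    exact ⟨minpoly.ne_zero hint, by rw [Polynomial.aeval_algHom_apply, minpoly.aeval, map_zero]⟩
  have hsplit : ((minpoly F x).map (algebraMap F L)).Splits := by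
    rw [← minpoly.algHom_eq φ (RingHom.injective _) x]
    exact Normal.splits inferInstance (φ x)
  rw [← hsplit.image_rootSet (IntermediateField.val L)] at hroot
  obtain ⟨y, -, hy⟩ := hroot
  rw [← hy, absoluteGaloisGroup.smul_def]
  set γ : AlgebraicClosure F ≃ₐ[F] AlgebraicClosure F := absoluteGaloisGroup.toAlgEquiv F (g ^ d) with hγ
  have h1 : γ (algebraMap L (AlgebraicClosure F) y) =
      algebraMap L (AlgebraicClosure F) (γ.restrictNormal L y) :=
    (AlgEquiv.restrictNormal_commutes γ L y).symm
  have h2 : γ.restrictNormal L = 1 := by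
    rw [show γ.restrictNormal L = AlgEquiv.restrictNormalHom L γ from rfl, hγ, map_pow, map_pow]
    exact hd _
  have h3 : (algebraMap L (AlgebraicClosure F) y) = IntermediateField.val L y := rfl
  rw [← h3, h1, h2, AlgEquiv.one_apply]

/-- **Fukuda's index is `n₀ = 0` for the cyclotomic `ℤ_p`-extension of every number field `K` that embeds into a
normal `L ⊆ ℚ̄` whose automorphism group has exponent dividing `d` with `p ∤ d`**: every prime of `\bar ℤ_K`
above a finite place is unramified or totally ramified in `K_∞/K` (`TotallyRamifiedFrom κ 0`). X8's §2
(`totallyRamifiedFrom_zero_of_isCyclotomic_of_pow_mem_range`: `w ∤ p` Washington Prop. 13.2; `w ∣ p` Hensel +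
total ramification of `p` in `ℚ(μ_{p^∞})`) with its hypothesis «`g^d ∈ res(Γ_K)`» supplied by
`pow_mem_range_absGaloisRestrict_of_algHom_normal`. A THEOREM (no named fact). [cite: Fukuda1994, p. 264 (the index `n₀`)]
[cite: Washington1997, §13.1 and Prop. 13.2] [cite: NeukirchANT1999, Ch. I §9 (9.4)–(9.6); Ch. II (7.13)(i)] -/
theorem totallyRamifiedFrom_zero_of_isCyclotomic_of_algHom_normal (K : Type) [Field K] [NumberField K]
    (L : IntermediateField ℚ (AlgebraicClosure ℚ)) [Normal ℚ L] (p d : ℕ) [Fact p.Prime] (hd : ¬ p ∣ d)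
    (hL : ∀ s : L ≃ₐ[ℚ] L, s ^ d = 1) (φ : K →ₐ[ℚ] L) (κ : ZpExtension K p) (hκ : κ.IsCyclotomic) :
    TotallyRamifiedFrom κ 0 :=
  totallyRamifiedFrom_zero_of_isCyclotomic_of_pow_mem_range K p d hd
    (fun g => @pow_mem_range_absGaloisRestrict_of_algHom_normal ℚ _ L ‹_› d hL K _ _ φ g) κ hκ

/-- The same with `d = #Aut(L/ℚ)`: **if `K` embeds into a normal `L ⊆ ℚ̄` with `p ∤ #Aut(L/ℚ)`, the cyclotomic
`ℤ_p`-extension of `K` has Fukuda index `0`** (`s ^ #Aut = 1`). [cite: Fukuda1994, p. 264 (the index `n₀`)]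
[cite: Washington1997, §13.1 and Prop. 13.2] -/
theorem totallyRamifiedFrom_zero_of_isCyclotomic_of_algHom_normal_of_not_dvd_card (K : Type) [Field K]
    [NumberField K] (L : IntermediateField ℚ (AlgebraicClosure ℚ)) [Normal ℚ L] (p : ℕ) [Fact p.Prime]
    (hd : ¬ p ∣ Nat.card (L ≃ₐ[ℚ] L)) (φ : K →ₐ[ℚ] L) (κ : ZpExtension K p) (hκ : κ.IsCyclotomic) :
    TotallyRamifiedFrom κ 0 :=
  totallyRamifiedFrom_zero_of_isCyclotomic_of_algHom_normal K L p _ hd (fun _ => pow_card_eq_one') φ κ hκ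

/-- **Fukuda's index is `0` for the cyclotomic `ℤ_p`-tower of EVERY intermediate field of `ℚ(W[p])/ℚ` when `W[p]`
is irreducible and `ρ̄_{W,p}` is not onto** — e.g. the maximal real subfield `ℚ(P) = ℚ(W[3])^c` of a `3Ns` / `3Nn`
row, the field on which the cell's Fukuda records read class numbers: `ℚ(W[p])/ℚ` is Galois and
`p ∤ #Gal(ℚ(W[p])/ℚ)` by Serre's Prop. 15 (tree theorem `SmallImageDickson.not_dvd_card_aut_divisionField`).
This DISCHARGES the displayed binder `hram` of the FukudaAt doors. [cite: Serre1972, §2.4 Prop. 15]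
[cite: Fukuda1994, p. 264 (the index `n₀`)] [cite: Washington1997, §13.1 and Prop. 13.2] -/
theorem totallyRamifiedFrom_zero_intermediateField_divisionField (W : WeierstrassCurve ℚ) [W.IsElliptic]
    (p : ℕ) [Fact p.Prime] (hirr : W.HasIrreducibleModPGaloisRep p)
    (hns : ¬ W.HasSurjectiveModNGaloisRep p)
    (K : haveI : NeZero p := ⟨(Fact.out : p.Prime).ne_zero⟩; IntermediateField ℚ ↥(W.divisionField p))
    (κ : ZpExtension ↥K p) (hκ : κ.IsCyclotomic) : TotallyRamifiedFrom κ 0 := by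
  haveI : NeZero p := ⟨(Fact.out : p.Prime).ne_zero⟩
  haveI : FiniteDimensional ℚ (W.divisionField p) := W.finiteDimensional_divisionField p
  haveI : IsGalois ℚ (W.divisionField p) := W.isGalois_divisionField p
  haveI : NumberField ↥K := NumberField.mk
  exact totallyRamifiedFrom_zero_of_isCyclotomic_of_algHom_normal_of_not_dvd_card ↥K (W.divisionField p) p
    (SmallImageDickson.not_dvd_card_aut_divisionField W p hirr hns) (IntermediateField.val K) κ hκ

end Galois

/-! ### §2 A split-Cartan-normaliser image is not surjective -/

/-- **A split-Cartan-normaliser image is not surjective**: if every `σ ∈ Γ_F` acts on `W[p]` through a diagonal or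
antidiagonal matrix in some basis, then `ρ̄_{W,p}` is not onto `Aut(W[p])` — the unipotent automorphism
`e⁻¹ ∘ (1 1; 0 1) ∘ e` is no `σ`, since `(1 1; 0 1)` is neither diagonal (`M 0 1 = 1`) nor antidiagonal (`M 0 0 = 1`).
Twin of the tree's `not_hasSurjectiveModNGaloisRep_of_hasNonsplitCartanModPImage`. [cite: Serre1972, §2.2 (the Cartan normalisers are proper subgroups)] -/
theorem not_hasSurjectiveModNGaloisRep_of_hasSplitCartanNormalizerModPImage {F : Type*} [Field F] {p : ℕ}
    [Fact p.Prime] (W : WeierstrassCurve F) (h : HasSplitCartanNormalizerModPImage W p) :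
    ¬ W.HasSurjectiveModNGaloisRep p := by
  obtain ⟨e, himg⟩ := h
  intro hsurj
  let u : W.geomTorsion p ≃+ W.geomTorsion p := e.trans ((unipotentAddEquiv p).trans e.symm)
  obtain ⟨σ, hσ⟩ := hsurj (Multiplicative.ofAdd u)
  have hσP : ∀ P : W.geomTorsion p, σ • P = u P := fun P => by
    rw [← galoisRepTorsion_apply W p σ P, hσ]
    rfl
  obtain ⟨M, hM, hMσ⟩ := himg σ
  have key : ∀ v : Fin 2 → ZMod p, M.mulVec v = (!![(1 : ZMod p), 1; 0, 1]).mulVec v := by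
    intro v
    have h1 := hMσ (e.symm v)
    rw [hσP] at h1
    simp only [u, AddEquiv.trans_apply, AddEquiv.apply_symm_apply, unipotentAddEquiv_apply] at h1
    exact h1.symm
  have hMU : M = !![(1 : ZMod p), 1; 0, 1] := Matrix.mulVec_injective (funext key)
  have h01 : M 0 1 = 1 := by rw [hMU]; simp
  have h00 : M 0 0 = 1 := by rw [hMU]; simp
  rcases hM.2 with ⟨h, -⟩ | ⟨h, -⟩
  · rw [h01] at h; exact one_ne_zero h
  · rw [h00] at h; exact one_ne_zero h


/-! ### §3 The `hram`-FREE Fukuda doors at `p = 3`: (A) at `(W, 3)` and U₀ on (t′) from ONE integer equality on `ℚ(P)` -/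

section FukudaDoors

variable (W : WeierstrassCurve ℚ) [W.IsElliptic]

set_option synthInstance.maxHeartbeats 400000 in
set_option maxHeartbeats 4000000 in
/-- **(A) at `(W,3)` on a `3Ns` row from Fukuda Thm. 1 (1) at layers `(n, n+1)` of the cyclotomic `ℤ_3`-tower of `ℚ(P) = ℚ(W[3])^c`,
`hram`-FREE** (modulo `hCS`, `hFW`, `hF1`): `W[3]` irreducible (`hirr`), image in `C_s⁺(3)` (`himg`), a complex conjugation `c`, and
`ord₃ h(ℚ(P)_{n+1}) = ord₃ h(ℚ(P)_n)` (`hord`); Fukuda's index `n₀ = 0` is §1 (`totallyRamifiedFrom_zero_intermediateField_divisionField`,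
Serre Prop. 15 + §2). CONDITIONAL on the named facts; (A) asserted for no curve. [cite: Fukuda1994, Thm. 1 (1), p. 264]
[cite: CoatesSujatha2005, Thm. 3.4 (§3)] [cite: Serre1972, §2.4 Prop. 15, §5.2 (iv)] [cite: Washington1997, §13.1] -/
theorem conjA_three_of_hasSplitCartanNormalizerModPImage_of_realSuccEqAt
    (hCS : CoatesSujatha2005.thm34_fineSelmerDual_moduleFinite_of_classicalMuVanishes_divisionField)
    (hFW : ferreroWashington1979_classicalMuVanishes) (hF1 : fukuda1994_thm1_classNumberPExp_const_of_succ_eq)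
    (hirr : W.HasIrreducibleModPGaloisRep 3) (himg : HasSplitCartanNormalizerModPImage W 3)
    {c : absoluteGaloisGroup ℚ} (hc : IsComplexConjugation (Rat.castHom ℝ) c) (n : ℕ)
    (hord : ∀ κE : ZpExtension ↥(fixedField (Subgroup.zpowers (absRestrictNormalHom (W.divisionField 3) c))) 3,
      κE.IsCyclotomic → classNumberPExp κE (n + 1) = classNumberPExp κE n)
    (κ : ZpExtension ℚ 3) (hκ : κ.IsCyclotomic) :
    ∃ (γ : absoluteGaloisGroup ℚ) (D : W.FineSelmerDualData κ γ),
      Module.Finite ℤ_[3] (RestrictScalars ℤ_[3] (IwasawaAlgebra 3) D.X) := by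
  haveI : Fact (Nat.Prime 3) := ⟨Nat.prime_three⟩
  haveI : NumberField ↥(W.divisionField 3) := NumberField.mk
  exact CartanMuRoadRealDoors.conjA_three_of_hasSplitCartanNormalizerModPImage_of_realMu W hCS hFW himg hc
    (fun κE hκE => classicalMuVanishes_of_classNumberPExp_succ_eq hF1 κE
      (totallyRamifiedFrom_zero_intermediateField_divisionField W 3 hirr
        (not_hasSurjectiveModNGaloisRep_of_hasSplitCartanNormalizerModPImage W himg) _ κE hκE)
      (Nat.zero_le n) (hord κE hκE)) κ hκ

set_option synthInstance.maxHeartbeats 400000 in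
set_option maxHeartbeats 4000000 in
/-- **(A) at `(W,3)` on a `3Ns` row from Fukuda Thm. 1 (2) (`3`-RANKS) at layers `(n, n+1)` of the tower of `ℚ(P)`, `hram`-FREE**
(modulo `hCS`, `hFW`, `hF2`): `rank₃ Cl(ℚ(P)_{n+1}) = rank₃ Cl(ℚ(P)_n)` (`hrk`). CONDITIONAL. [cite: Fukuda1994, Thm. 1 (2), p. 264]
[cite: CoatesSujatha2005, Thm. 3.4 (§3)] [cite: Serre1972, §2.4 Prop. 15, §5.2 (iv)] -/
theorem conjA_three_of_hasSplitCartanNormalizerModPImage_of_realRankSuccEqAt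
    (hCS : CoatesSujatha2005.thm34_fineSelmerDual_moduleFinite_of_classicalMuVanishes_divisionField)
    (hFW : ferreroWashington1979_classicalMuVanishes) (hF2 : fukuda1994_thm1_classGroupPRank_const_of_succ_eq)
    (hirr : W.HasIrreducibleModPGaloisRep 3) (himg : HasSplitCartanNormalizerModPImage W 3)
    {c : absoluteGaloisGroup ℚ} (hc : IsComplexConjugation (Rat.castHom ℝ) c) (n : ℕ)
    (hrk : ∀ κE : ZpExtension ↥(fixedField (Subgroup.zpowers (absRestrictNormalHom (W.divisionField 3) c))) 3,
      κE.IsCyclotomic → classGroupPRank κE (n + 1) = classGroupPRank κE n)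
    (κ : ZpExtension ℚ 3) (hκ : κ.IsCyclotomic) :
    ∃ (γ : absoluteGaloisGroup ℚ) (D : W.FineSelmerDualData κ γ),
      Module.Finite ℤ_[3] (RestrictScalars ℤ_[3] (IwasawaAlgebra 3) D.X) := by
  haveI : Fact (Nat.Prime 3) := ⟨Nat.prime_three⟩
  haveI : NumberField ↥(W.divisionField 3) := NumberField.mk
  exact CartanMuRoadRealDoors.conjA_three_of_hasSplitCartanNormalizerModPImage_of_realMu W hCS hFW himg hc
    (fun κE hκE => classicalMuVanishes_of_classGroupPRank_succ_eq hF2 κE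
      (totallyRamifiedFrom_zero_intermediateField_divisionField W 3 hirr
        (not_hasSurjectiveModNGaloisRep_of_hasSplitCartanNormalizerModPImage W himg) _ κE hκE)
      (Nat.zero_le n) (hrk κE hκE)) κ hκ

set_option synthInstance.maxHeartbeats 400000 in
set_option maxHeartbeats 4000000 in
/-- **(A) at `(W,3)` on a `3Nn` row from Fukuda Thm. 1 (1) at layers `(n, n+1)` of the tower of `ℚ(P) = ℚ(W[3])^c` (degree `8`),
`hram`-FREE, paying Iwasawa's growth theorem `hI`** (modulo `hCS`, `hI`, `hFW`, `hF1`): image EQUAL to `C_ns⁺(3)` (`himg`), `W[3]`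
irreducible (`hirr`), a complex conjugation `c`, `ord₃ h(ℚ(P)_{n+1}) = ord₃ h(ℚ(P)_n)` (`hord`). The door for the 19 KT `3Nn` U₀-ns rows
graded FUKUDA-L(0,1) (`e₀ = e₁ = 2`). CONDITIONAL. [cite: Fukuda1994, Thm. 1 (1), p. 264] [cite: CoatesSujatha2005, Thm. 3.4 (§3)]
[cite: Serre1972, §2.4 Prop. 15, §5.2 (iv)] [cite: Washington1997, §13.1] -/
theorem conjA_three_of_hasModPImageEqNonsplitCartanNormalizer_of_realSuccEqAt'
    (hCS : CoatesSujatha2005.thm34_fineSelmerDual_moduleFinite_of_classicalMuVanishes_divisionField)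
    (hI : iwasawa1959_classNumberPExp_growth) (hFW : ferreroWashington1979_classicalMuVanishes)
    (hF1 : fukuda1994_thm1_classNumberPExp_const_of_succ_eq)
    (hirr : W.HasIrreducibleModPGaloisRep 3) (himg : HasModPImageEqNonsplitCartanNormalizer W 3)
    {c : absoluteGaloisGroup ℚ} (hc : IsComplexConjugation (Rat.castHom ℝ) c) (n : ℕ)
    (hord : ∀ κE : ZpExtension ↥(fixedField (Subgroup.zpowers (absRestrictNormalHom (W.divisionField 3) c))) 3,
      κE.IsCyclotomic → classNumberPExp κE (n + 1) = classNumberPExp κE n)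
    (κ : ZpExtension ℚ 3) (hκ : κ.IsCyclotomic) :
    ∃ (γ : absoluteGaloisGroup ℚ) (D : W.FineSelmerDualData κ γ),
      Module.Finite ℤ_[3] (RestrictScalars ℤ_[3] (IwasawaAlgebra 3) D.X) := by
  haveI : Fact (Nat.Prime 3) := ⟨Nat.prime_three⟩
  haveI : NumberField ↥(W.divisionField 3) := NumberField.mk
  exact CartanMuRoadRealDoors.conjA_three_of_hasModPImageEqNonsplitCartanNormalizer_of_realMu' W hCS hI hFW himg hc
    (fun κE hκE => classicalMuVanishes_of_classNumberPExp_succ_eq hF1 κE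
      (totallyRamifiedFrom_zero_intermediateField_divisionField W 3 hirr
        (not_hasSurjectiveModNGaloisRep_of_hasNonsplitCartanModPImage W himg.hasNonsplitCartanModPImage) _ κE hκE)
      (Nat.zero_le n) (hord κE hκE)) κ hκ

set_option synthInstance.maxHeartbeats 400000 in
set_option maxHeartbeats 4000000 in
/-- **(A) at `(W,3)` on a `3Nn` row from Fukuda Thm. 1 (2) (`3`-RANKS) at layers `(n, n+1)` of the tower of `ℚ(P)`, `hram`-FREE, paying
`hI`** (modulo `hCS`, `hI`, `hFW`, `hF2`): `rank₃ Cl(ℚ(P)_{n+1}) = rank₃ Cl(ℚ(P)_n)` (`hrk`). The door for the KT rows 198927v1,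
486720db1, 486720dc1 (RANK-STABLE at `(0,1)`). CONDITIONAL. [cite: Fukuda1994, Thm. 1 (2), p. 264] [cite: CoatesSujatha2005, Thm. 3.4 (§3)]
[cite: Serre1972, §2.4 Prop. 15, §5.2 (iv)] -/
theorem conjA_three_of_hasModPImageEqNonsplitCartanNormalizer_of_realRankSuccEqAt'
    (hCS : CoatesSujatha2005.thm34_fineSelmerDual_moduleFinite_of_classicalMuVanishes_divisionField)
    (hI : iwasawa1959_classNumberPExp_growth) (hFW : ferreroWashington1979_classicalMuVanishes)
    (hF2 : fukuda1994_thm1_classGroupPRank_const_of_succ_eq)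
    (hirr : W.HasIrreducibleModPGaloisRep 3) (himg : HasModPImageEqNonsplitCartanNormalizer W 3)
    {c : absoluteGaloisGroup ℚ} (hc : IsComplexConjugation (Rat.castHom ℝ) c) (n : ℕ)
    (hrk : ∀ κE : ZpExtension ↥(fixedField (Subgroup.zpowers (absRestrictNormalHom (W.divisionField 3) c))) 3,
      κE.IsCyclotomic → classGroupPRank κE (n + 1) = classGroupPRank κE n)
    (κ : ZpExtension ℚ 3) (hκ : κ.IsCyclotomic) :
    ∃ (γ : absoluteGaloisGroup ℚ) (D : W.FineSelmerDualData κ γ),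
      Module.Finite ℤ_[3] (RestrictScalars ℤ_[3] (IwasawaAlgebra 3) D.X) := by
  haveI : Fact (Nat.Prime 3) := ⟨Nat.prime_three⟩
  haveI : NumberField ↥(W.divisionField 3) := NumberField.mk
  exact CartanMuRoadRealDoors.conjA_three_of_hasModPImageEqNonsplitCartanNormalizer_of_realMu' W hCS hI hFW himg hc
    (fun κE hκE => classicalMuVanishes_of_classGroupPRank_succ_eq hF2 κE
      (totallyRamifiedFrom_zero_intermediateField_divisionField W 3 hirr
        (not_hasSurjectiveModNGaloisRep_of_hasNonsplitCartanModPImage W himg.hasNonsplitCartanModPImage) _ κE hκE)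
      (Nat.zero_le n) (hrk κE hκE)) κ hκ

end FukudaDoors

section FukudaUpper

variable (W : WeierstrassCurve ℚ) [W.IsElliptic] [W.IsGloballyMinimal]

set_option synthInstance.maxHeartbeats 400000 in
set_option maxHeartbeats 4000000 in
/-- **U₀ at a `3Ns` (t′) row from Fukuda Thm. 1 (1) on `ℚ(P)`, `hram`-FREE**: `ord₃ #Ш(W) ≤ ord₃ #Ш_an(W)` (`MissingUpperBoundAt W 3`)
for a rank-`0` (t′) row (`Addv W 3`, `SubTprime W 3`) with `W[3]` irreducible and image in `C_s⁺(3)`, from the named facts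
`hKatoA hGZK hmod hCS hFW hF1`, a complex conjugation `c` and ONE integer equality `ord₃ h(ℚ(P)_{n+1}) = ord₃ h(ℚ(P)_n)`.
CONDITIONAL; nothing booked; BSD for no curve. [cite: Kato2004Asterisque, Thm. 14.5 (3) (p. 236), Thm. 12.5 (3) (p. 222)]
[cite: Fukuda1994, Thm. 1 (1), p. 264] [cite: CoatesSujatha2005, Thm. 3.4 (§3)] [cite: Serre1972, §2.4 Prop. 15, §5.2 (iv)] -/
theorem missingUpperBoundAt_three_tame_of_hasSplitCartanNormalizerModPImage_of_realSuccEqAt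
    (hKatoA : Kato2004.rankZero_padicValNat_sha_add_padicValNat_tamagawa_le_of_additive_potGood_of_irreducible_of_fineSelmerDual_fg)
    (hGZK : rank_eq_analyticRank_of_analyticRank_le_one) (hmod : hasEntireLFunction_rat)
    (hCS : CoatesSujatha2005.thm34_fineSelmerDual_moduleFinite_of_classicalMuVanishes_divisionField)
    (hFW : ferreroWashington1979_classicalMuVanishes) (hF1 : fukuda1994_thm1_classNumberPExp_const_of_succ_eq)
    [Fact (3 : ℕ).Prime] (hr : W.analyticRank = 0) (hadd : Addv W 3) (hT : SubTprime W 3)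
    (hirr : W.HasIrreducibleModPGaloisRep 3) (himg : HasSplitCartanNormalizerModPImage W 3)
    {c : absoluteGaloisGroup ℚ} (hc : IsComplexConjugation (Rat.castHom ℝ) c) (n : ℕ)
    (hord : ∀ κE : ZpExtension ↥(fixedField (Subgroup.zpowers (absRestrictNormalHom (W.divisionField 3) c))) 3,
      κE.IsCyclotomic → classNumberPExp κE (n + 1) = classNumberPExp κE n) :
    MissingUpperBoundAt W 3 := by
  haveI : NumberField ↥(W.divisionField 3) := NumberField.mk
  exact CartanMuRoadRealDoorsTprime.missingUpperBoundAt_three_tame_of_hasSplitCartanNormalizerModPImage_of_realMu W hKatoA hGZK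
    hmod hCS hFW hr hadd hT hirr himg hc
    (fun κE hκE => classicalMuVanishes_of_classNumberPExp_succ_eq hF1 κE
      (totallyRamifiedFrom_zero_intermediateField_divisionField W 3 hirr
        (not_hasSurjectiveModNGaloisRep_of_hasSplitCartanNormalizerModPImage W himg) _ κE hκE)
      (Nat.zero_le n) (hord κE hκE))

set_option synthInstance.maxHeartbeats 400000 in
set_option maxHeartbeats 4000000 in
/-- **U₀ at a `3Ns` (t′) row from Fukuda Thm. 1 (2) (`3`-ranks) on `ℚ(P)`, `hram`-FREE** (named facts `hKatoA hGZK hmod hCS hFW hF2`;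
`rank₃ Cl(ℚ(P)_{n+1}) = rank₃ Cl(ℚ(P)_n)`). CONDITIONAL; nothing booked; BSD for no curve.
[cite: Kato2004Asterisque, Thm. 14.5 (3) (p. 236)] [cite: Fukuda1994, Thm. 1 (2), p. 264] [cite: CoatesSujatha2005, Thm. 3.4 (§3)]
[cite: Serre1972, §2.4 Prop. 15, §5.2 (iv)] -/
theorem missingUpperBoundAt_three_tame_of_hasSplitCartanNormalizerModPImage_of_realRankSuccEqAt
    (hKatoA : Kato2004.rankZero_padicValNat_sha_add_padicValNat_tamagawa_le_of_additive_potGood_of_irreducible_of_fineSelmerDual_fg)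
    (hGZK : rank_eq_analyticRank_of_analyticRank_le_one) (hmod : hasEntireLFunction_rat)
    (hCS : CoatesSujatha2005.thm34_fineSelmerDual_moduleFinite_of_classicalMuVanishes_divisionField)
    (hFW : ferreroWashington1979_classicalMuVanishes) (hF2 : fukuda1994_thm1_classGroupPRank_const_of_succ_eq)
    [Fact (3 : ℕ).Prime] (hr : W.analyticRank = 0) (hadd : Addv W 3) (hT : SubTprime W 3)
    (hirr : W.HasIrreducibleModPGaloisRep 3) (himg : HasSplitCartanNormalizerModPImage W 3)
    {c : absoluteGaloisGroup ℚ} (hc : IsComplexConjugation (Rat.castHom ℝ) c) (n : ℕ)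
    (hrk : ∀ κE : ZpExtension ↥(fixedField (Subgroup.zpowers (absRestrictNormalHom (W.divisionField 3) c))) 3,
      κE.IsCyclotomic → classGroupPRank κE (n + 1) = classGroupPRank κE n) :
    MissingUpperBoundAt W 3 := by
  haveI : NumberField ↥(W.divisionField 3) := NumberField.mk
  exact CartanMuRoadRealDoorsTprime.missingUpperBoundAt_three_tame_of_hasSplitCartanNormalizerModPImage_of_realMu W hKatoA hGZK
    hmod hCS hFW hr hadd hT hirr himg hc
    (fun κE hκE => classicalMuVanishes_of_classGroupPRank_succ_eq hF2 κE
      (totallyRamifiedFrom_zero_intermediateField_divisionField W 3 hirr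
        (not_hasSurjectiveModNGaloisRep_of_hasSplitCartanNormalizerModPImage W himg) _ κE hκE)
      (Nat.zero_le n) (hrk κE hκE))

set_option synthInstance.maxHeartbeats 400000 in
set_option maxHeartbeats 4000000 in
/-- **U₀ at a `3Nn` (t′) row from Fukuda Thm. 1 (1) on `ℚ(P)` (degree `8`), `hram`-FREE, paying `hI`**: `MissingUpperBoundAt W 3` for a
rank-`0` (t′) row with `W[3]` irreducible and image EQUAL to `C_ns⁺(3)`, from the named facts `hKatoA hGZK hmod hCS hI hFW hF1`, a complex
conjugation `c` and ONE integer equality `ord₃ h(ℚ(P)_{n+1}) = ord₃ h(ℚ(P)_n)` — the per-row door of the 19 KT FUKUDA-L(0,1) `3Nn` rows.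
CONDITIONAL; nothing booked; BSD for no curve. [cite: Kato2004Asterisque, Thm. 14.5 (3) (p. 236), Thm. 12.5 (3) (p. 222)]
[cite: Fukuda1994, Thm. 1 (1), p. 264] [cite: CoatesSujatha2005, Thm. 3.4 (§3)] [cite: Serre1972, §2.4 Prop. 15, §5.2 (iv)]
[cite: Washington1997, §13.1] -/
theorem missingUpperBoundAt_three_tame_of_hasModPImageEqNonsplitCartanNormalizer_of_realSuccEqAt'
    (hKatoA : Kato2004.rankZero_padicValNat_sha_add_padicValNat_tamagawa_le_of_additive_potGood_of_irreducible_of_fineSelmerDual_fg)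
    (hGZK : rank_eq_analyticRank_of_analyticRank_le_one) (hmod : hasEntireLFunction_rat)
    (hCS : CoatesSujatha2005.thm34_fineSelmerDual_moduleFinite_of_classicalMuVanishes_divisionField)
    (hI : iwasawa1959_classNumberPExp_growth) (hFW : ferreroWashington1979_classicalMuVanishes)
    (hF1 : fukuda1994_thm1_classNumberPExp_const_of_succ_eq)
    [Fact (3 : ℕ).Prime] (hr : W.analyticRank = 0) (hadd : Addv W 3) (hT : SubTprime W 3)
    (hirr : W.HasIrreducibleModPGaloisRep 3) (himg : HasModPImageEqNonsplitCartanNormalizer W 3)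
    {c : absoluteGaloisGroup ℚ} (hc : IsComplexConjugation (Rat.castHom ℝ) c) (n : ℕ)
    (hord : ∀ κE : ZpExtension ↥(fixedField (Subgroup.zpowers (absRestrictNormalHom (W.divisionField 3) c))) 3,
      κE.IsCyclotomic → classNumberPExp κE (n + 1) = classNumberPExp κE n) :
    MissingUpperBoundAt W 3 := by
  haveI : NumberField ↥(W.divisionField 3) := NumberField.mk
  exact CartanMuRoadRealDoorsTprime.missingUpperBoundAt_three_tame_of_hasModPImageEqNonsplitCartanNormalizer_of_realMu' W hKatoA
    hGZK hmod hCS hI hFW hr hadd hT hirr himg hc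
    (fun κE hκE => classicalMuVanishes_of_classNumberPExp_succ_eq hF1 κE
      (totallyRamifiedFrom_zero_intermediateField_divisionField W 3 hirr
        (not_hasSurjectiveModNGaloisRep_of_hasNonsplitCartanModPImage W himg.hasNonsplitCartanModPImage) _ κE hκE)
      (Nat.zero_le n) (hord κE hκE))

set_option synthInstance.maxHeartbeats 400000 in
set_option maxHeartbeats 4000000 in
/-- **U₀ at a `3Nn` (t′) row from Fukuda Thm. 1 (2) (`3`-ranks) on `ℚ(P)`, `hram`-FREE, paying `hI`** (named facts
`hKatoA hGZK hmod hCS hI hFW hF2`; `rank₃ Cl(ℚ(P)_{n+1}) = rank₃ Cl(ℚ(P)_n)`) — the door for the RANK-STABLE KT rows. CONDITIONAL;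
nothing booked; BSD for no curve. [cite: Kato2004Asterisque, Thm. 14.5 (3) (p. 236)] [cite: Fukuda1994, Thm. 1 (2), p. 264]
[cite: CoatesSujatha2005, Thm. 3.4 (§3)] [cite: Serre1972, §2.4 Prop. 15, §5.2 (iv)] -/
theorem missingUpperBoundAt_three_tame_of_hasModPImageEqNonsplitCartanNormalizer_of_realRankSuccEqAt'
    (hKatoA : Kato2004.rankZero_padicValNat_sha_add_padicValNat_tamagawa_le_of_additive_potGood_of_irreducible_of_fineSelmerDual_fg)
    (hGZK : rank_eq_analyticRank_of_analyticRank_le_one) (hmod : hasEntireLFunction_rat)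
    (hCS : CoatesSujatha2005.thm34_fineSelmerDual_moduleFinite_of_classicalMuVanishes_divisionField)
    (hI : iwasawa1959_classNumberPExp_growth) (hFW : ferreroWashington1979_classicalMuVanishes)
    (hF2 : fukuda1994_thm1_classGroupPRank_const_of_succ_eq)
    [Fact (3 : ℕ).Prime] (hr : W.analyticRank = 0) (hadd : Addv W 3) (hT : SubTprime W 3)
    (hirr : W.HasIrreducibleModPGaloisRep 3) (himg : HasModPImageEqNonsplitCartanNormalizer W 3)
    {c : absoluteGaloisGroup ℚ} (hc : IsComplexConjugation (Rat.castHom ℝ) c) (n : ℕ)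
    (hrk : ∀ κE : ZpExtension ↥(fixedField (Subgroup.zpowers (absRestrictNormalHom (W.divisionField 3) c))) 3,
      κE.IsCyclotomic → classGroupPRank κE (n + 1) = classGroupPRank κE n) :
    MissingUpperBoundAt W 3 := by
  haveI : NumberField ↥(W.divisionField 3) := NumberField.mk
  exact CartanMuRoadRealDoorsTprime.missingUpperBoundAt_three_tame_of_hasModPImageEqNonsplitCartanNormalizer_of_realMu' W hKatoA
    hGZK hmod hCS hI hFW hr hadd hT hirr himg hc
    (fun κE hκE => classicalMuVanishes_of_classGroupPRank_succ_eq hF2 κE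
      (totallyRamifiedFrom_zero_intermediateField_divisionField W 3 hirr
        (not_hasSurjectiveModNGaloisRep_of_hasNonsplitCartanModPImage W himg.hasNonsplitCartanModPImage) _ κE hκE)
      (Nat.zero_le n) (hrk κE hκE))

end FukudaUpper

end Summit.BirchSwinnertonDyer.BirchSwinnertonDyer.Theorems.CartanMuRoadFukudaDoorsTprime

end
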